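import Mathlib
import HarnessLib

/-!
# Crux `MobiusLadder.LiouvilleOrthogonalTC0` (stmt-QuantumAdvantage-1393), line `Sketch`, skeleton v9:
stub `stub_windowAverage` (T1a) — sliding windows of length `h` control aligned blocks of length `H ≥ h`

For a `1`-bounded `f : ℕ → ℝ`, `h ≤ H` and `h ≤ X`:
`h · Σ_{i<M} |Σ_{N ∈ [X+iH, X+(i+1)H)} f N| ≤ 2 · Σ_{x ∈ [X−h, X+MH)} |Σ_{N ∈ (x, x+h]} f N| + 2h²M`.
Pure double counting, no number theory. For one block `B = [a, b)` with `h ≤ a ≤ b`, the windows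
`W_x = (x, x+h]` and the range of left end-points `R = [a−h, b)`: every `N ∈ B` lies in exactly
`h` windows (`x ∈ [N−h, N) ⊆ R`), so `Σ_{x∈R} Σ_{W_x ∩ B} g = h · Σ_B g` for every `g`
(`windowAverage_doubleCount`). With `g = f` this gives `h |Σ_B f| ≤ Σ_{x∈R} |Σ_{W_x ∩ B} f|`, and
`|Σ_{W_x ∩ B} f| ≤ |Σ_{W_x} f| + #(W_x ∖ B) = |Σ_{W_x} f| + h − #(W_x ∩ B)`; with `g = 1` it gives
`Σ_{x∈R} #(W_x ∩ B) = h · #B`, while `h · #R = h · (#B + h)`, whence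
`h |Σ_B f| ≤ Σ_{x∈R} |Σ_{W_x} f| + h²` (`windowAverage_block`). Summing over the blocks
`a = X + iH`, `i < M`: consecutive ranges `[X+iH−h, X+(i+1)H)` overlap only on
`[X+(i+1)H−h, X+(i+1)H)`, which lies inside the next block because `h ≤ H`, so every
`x ∈ [X−h, X+MH)` is counted at most twice (`windowAverage_overlap`, induction on `M`); in total
`h Σ_i |Σ_{B_i} f| ≤ 2 Σ_x |Σ_{W_x} f| + h²M ≤ 2 Σ_x |Σ_{W_x} f| + 2h²M`.
-/

set_option linter.dupNamespace false -- D-0017: single-problem summit ⇒ `QuantumAdvantage.QuantumAdvantage` by design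

noncomputable section

namespace Summit.QuantumAdvantage.QuantumAdvantage.Theorems.LiouvilleOrthogonalTC0

open Finset

/-- Double counting of block/window incidences: for `h ≤ a`, every `N ∈ [a, b)` lies in exactly
`h` windows `(x, x+h]`, namely those with `x ∈ [N−h, N)`, all of which start in `[a−h, b)`; hence
`Σ_{x ∈ [a−h, b)} Σ_{N ∈ (x, x+h] ∩ [a, b)} g N = h · Σ_{N ∈ [a, b)} g N`. -/
theorem windowAverage_doubleCount (g : ℕ → ℝ) (a b h : ℕ) (hha : h ≤ a) :
    ∑ x ∈ Ico (a - h) b, ∑ N ∈ Ioc x (x + h) ∩ Ico a b, g N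
      = (h : ℝ) * ∑ N ∈ Ico a b, g N := by
  rw [Finset.sum_comm' (t' := Ico a b) (s' := fun N => Ico (N - h) N)]
  · rw [Finset.mul_sum]
    refine Finset.sum_congr rfl fun N hN => ?_
    rw [Finset.sum_const, nsmul_eq_mul, Nat.card_Ico,
      Nat.sub_sub_self (hha.trans (Finset.mem_Ico.mp hN).1)]
  · intro x N
    simp only [Finset.mem_Ico, Finset.mem_Ioc, Finset.mem_inter]
    omega

/-- One aligned block against the sliding windows around it: for a `1`-bounded `f` and
`h ≤ a ≤ b`, `h · |Σ_{N ∈ [a, b)} f N| ≤ Σ_{x ∈ [a−h, b)} |Σ_{N ∈ (x, x+h]} f N| + h²`. -/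
theorem windowAverage_block (f : ℕ → ℝ) (hf : ∀ N, |f N| ≤ 1) (a b h : ℕ) (hha : h ≤ a)
    (hab : a ≤ b) :
    (h : ℝ) * |∑ N ∈ Ico a b, f N|
      ≤ ∑ x ∈ Ico (a - h) b, |∑ N ∈ Ioc x (x + h), f N| + (h : ℝ) * h := by
  -- per-window estimate: `|Σ_{W ∩ B} f| + #(W ∩ B) ≤ |Σ_W f| + h`
  have hwin : ∀ x, |∑ N ∈ Ioc x (x + h) ∩ Ico a b, f N| + ((Ioc x (x + h) ∩ Ico a b).card : ℝ)
      ≤ |∑ N ∈ Ioc x (x + h), f N| + h := by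
    intro x
    have hsplit := Finset.sum_inter_add_sum_sdiff (Ioc x (x + h)) (Ico a b) f
    have hcard : ((Ioc x (x + h) ∩ Ico a b).card : ℝ) + ((Ioc x (x + h) \ Ico a b).card : ℝ)
        = h := by
      have hc := Finset.card_inter_add_card_sdiff (Ioc x (x + h)) (Ico a b)
      rw [Nat.card_Ioc, Nat.add_sub_cancel_left] at hc
      exact_mod_cast hc
    have hout : |∑ N ∈ Ioc x (x + h) \ Ico a b, f N| ≤ ((Ioc x (x + h) \ Ico a b).card : ℝ) :=
      calc |∑ N ∈ Ioc x (x + h) \ Ico a b, f N|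
          ≤ ∑ N ∈ Ioc x (x + h) \ Ico a b, |f N| := Finset.abs_sum_le_sum_abs _ _
        _ ≤ ∑ N ∈ Ioc x (x + h) \ Ico a b, (1 : ℝ) := Finset.sum_le_sum fun N _ => hf N
        _ = ((Ioc x (x + h) \ Ico a b).card : ℝ) := by
          rw [Finset.sum_const, nsmul_eq_mul, mul_one]
    have htri : |∑ N ∈ Ioc x (x + h) ∩ Ico a b, f N|
        ≤ |∑ N ∈ Ioc x (x + h), f N| + |∑ N ∈ Ioc x (x + h) \ Ico a b, f N| := by
      rw [eq_sub_of_add_eq hsplit]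
      exact abs_sub _ _
    linarith
  -- sum the per-window estimates over `x ∈ [a−h, b)` and insert the two double counts
  have hsum := Finset.sum_le_sum fun x (_ : x ∈ Ico (a - h) b) => hwin x
  rw [Finset.sum_add_distrib, Finset.sum_add_distrib] at hsum
  have e1 := windowAverage_doubleCount f a b h hha
  have e2 : ∑ x ∈ Ico (a - h) b, ((Ioc x (x + h) ∩ Ico a b).card : ℝ)
      = (h : ℝ) * ((Ico a b).card : ℝ) := by
    have h1 := windowAverage_doubleCount (fun _ => (1 : ℝ)) a b h hha
    simp only [Finset.sum_const, nsmul_eq_mul, mul_one] at h1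
    exact h1
  have hR : ((Ico (a - h) b).card : ℝ) = ((Ico a b).card : ℝ) + h := by
    have h1 : (Ico (a - h) b).card = (Ico a b).card + h := by
      simp only [Nat.card_Ico]
      omega
    exact_mod_cast h1
  have hconst : ∑ _x ∈ Ico (a - h) b, (h : ℝ) = (((Ico a b).card : ℝ) + h) * h := by
    rw [Finset.sum_const, nsmul_eq_mul, hR]
  rw [e2, hconst] at hsum
  have habs : (h : ℝ) * |∑ N ∈ Ico a b, f N|
      ≤ ∑ x ∈ Ico (a - h) b, |∑ N ∈ Ioc x (x + h) ∩ Ico a b, f N| :=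
    calc (h : ℝ) * |∑ N ∈ Ico a b, f N| = |(h : ℝ) * ∑ N ∈ Ico a b, f N| := by
          rw [abs_mul, Nat.abs_cast]
      _ = |∑ x ∈ Ico (a - h) b, ∑ N ∈ Ioc x (x + h) ∩ Ico a b, f N| := by rw [e1]
      _ ≤ _ := Finset.abs_sum_le_sum_abs _ _
  linarith [habs, hsum]

/-- Overlap count for the ranges of left end-points: if `a i + h ≤ a (i+1)` for all `i`, the ranges
`[a i − h, a (i+1))`, `i < M`, together with the spill-over `[a M − h, a M)`, cover every point of
`[a 0 − h, a M)` at most twice (for a pointwise nonnegative weight `g`). -/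
theorem windowAverage_overlap (g : ℕ → ℝ) (hg : ∀ x, 0 ≤ g x) (a : ℕ → ℕ) (h : ℕ)
    (ha : ∀ i, a i + h ≤ a (i + 1)) (M : ℕ) :
    ∑ i ∈ range M, ∑ x ∈ Ico (a i - h) (a (i + 1)), g x + ∑ x ∈ Ico (a M - h) (a M), g x
      ≤ 2 * ∑ x ∈ Ico (a 0 - h) (a M), g x := by
  induction M with
  | zero =>
    simp only [Finset.range_zero, Finset.sum_empty, zero_add]
    have h0 := Finset.sum_nonneg fun x (_ : x ∈ Ico (a 0 - h) (a 0)) => hg x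
    linarith
  | succ M ih =>
    have hmono : a 0 ≤ a M :=
      (monotone_nat_of_le_succ (f := a) fun i => by have := ha i; omega) (Nat.zero_le M)
    have hM := ha M
    have h1 : ∑ x ∈ Ico (a M - h) (a (M + 1)), g x
        = ∑ x ∈ Ico (a M - h) (a M), g x + ∑ x ∈ Ico (a M) (a (M + 1)), g x :=
      (Finset.sum_Ico_consecutive g (Nat.sub_le (a M) h) (by omega)).symm
    have h2 : ∑ x ∈ Ico (a (M + 1) - h) (a (M + 1)), g x ≤ ∑ x ∈ Ico (a M) (a (M + 1)), g x :=
      Finset.sum_le_sum_of_subset_of_nonneg (Finset.Ico_subset_Ico (by omega) le_rfl)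
        fun x _ _ => hg x
    have h3 : ∑ x ∈ Ico (a 0 - h) (a (M + 1)), g x
        = ∑ x ∈ Ico (a 0 - h) (a M), g x + ∑ x ∈ Ico (a M) (a (M + 1)), g x :=
      (Finset.sum_Ico_consecutive g (by omega) (by omega)).symm
    rw [Finset.sum_range_succ, h1, h3]
    linarith [ih, h2]

/-- **Stub `stub_windowAverage` (line `Sketch`, v9, T1a) — averaging sliding windows inside aligned
blocks.** For `|f| ≤ 1`, `1 ≤ h ≤ H`, `h ≤ X` and the `M` aligned blocks
`B_i = [X + iH, X + (i+1)H)`: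
`h · Σ_i |Σ_{B_i} f| ≤ 2 Σ_{x ∈ [X−h, X+MH)} |Σ_{(x, x+h]} f| + 2h²M`.
Each block costs `Σ_{x ∈ [X+iH−h, X+(i+1)H)} |Σ_{(x,x+h]} f| + h²` (`windowAverage_block`), and the
ranges of left end-points cover `[X−h, X+MH)` at most twice (`windowAverage_overlap`). -/
theorem stub_windowAverage (f : ℕ → ℝ) (hf : ∀ N, |f N| ≤ 1) (X H h M : ℕ) (hh : 1 ≤ h)
    (hhH : h ≤ H) (hhX : h ≤ X) :
    (h : ℝ) * ∑ i ∈ Finset.range M, |∑ N ∈ Finset.Ico (X + i * H) (X + (i + 1) * H), f N|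
      ≤ 2 * ∑ x ∈ Finset.Ico (X - h) (X + M * H), |∑ N ∈ Finset.Ioc x (x + h), f N|
        + 2 * (h : ℝ) ^ 2 * M := by
  -- consecutive block starts are `H ≥ h` apart
  have ha : ∀ i, X + i * H + h ≤ X + (i + 1) * H := by
    intro i
    rw [add_mul, one_mul]
    omega
  -- each block: windows over its own range of left end-points, plus `h²`
  have hblock : ∀ i ∈ range M, (h : ℝ) * |∑ N ∈ Ico (X + i * H) (X + (i + 1) * H), f N|
      ≤ ∑ x ∈ Ico (X + i * H - h) (X + (i + 1) * H), |∑ N ∈ Ioc x (x + h), f N|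
        + (h : ℝ) * h := by
    intro i _
    have hi := ha i
    exact windowAverage_block f hf (X + i * H) (X + (i + 1) * H) h (by omega) (by omega)
  have hsum := Finset.sum_le_sum hblock
  rw [← Finset.mul_sum, Finset.sum_add_distrib, Finset.sum_const, Finset.card_range,
    nsmul_eq_mul] at hsum
  -- the ranges of left end-points cover `[X - h, X + M H)` at most twice
  have hover := windowAverage_overlap (fun x => |∑ N ∈ Ioc x (x + h), f N|)
    (fun x => abs_nonneg _) (fun i => X + i * H) h ha M
  simp only [zero_mul, add_zero] at hover
  have hE : 0 ≤ ∑ x ∈ Ico (X + M * H - h) (X + M * H), |∑ N ∈ Ioc x (x + h), f N| :=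
    Finset.sum_nonneg fun x _ => abs_nonneg _
  -- the slack `h² M ≤ 2 h² M`
  have h1 : (1 : ℝ) ≤ h := by exact_mod_cast hh
  have hM : (0 : ℝ) ≤ M := Nat.cast_nonneg M
  have hslack : (0 : ℝ) ≤ (h : ℝ) ^ 2 * M := by positivity
  nlinarith [hsum, hover, hE, hslack, h1, hM]

end Summit.QuantumAdvantage.QuantumAdvantage.Theorems.LiouvilleOrthogonalTC0

end
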